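import Mathlib
import HarnessLib
import Summits.NavierStokesRegularity.NavierStokesRegularity.Theorems.LocalSineTubeDoorLocalPointZoomDiag
import Summits.NavierStokesRegularity.NavierStokesRegularity.Theorems.LocalSineTubeDoorLocalPointZoomGradSlices
import Summits.NavierStokesRegularity.NavierStokesRegularity.Theorems.LocalVelCompTubeDoorLocalPointZoomVelSlices
import Summits.NavierStokesRegularity.NavierStokesRegularity.Theorems.LocalSineTubeDoorLocalPointZoomGrad

/-!
# The door family's FIRST-ORDER zoom with DIAGONAL convergence on every slice: velocities AND gradients along moving
# points `yⱼ → y`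

Cell ns-regularity-ideate, seat p6 (route-directed support for the door family of LADDER-NS N0; same frame and proof
skeleton as `…LocalSineTubeDoorLocalPointZoomGradSlices.localPointZoomVelGradSlices` (p441522, the universal first-order
zoom K1 of the doors S12/S13), with the pointwise upgrades `localZoomFrame_tendsto` / `localZoomFrame_fderiv_tendsto` at
the slice `−1` of the `σ = √(−s)`-rescaled frame replaced by the DIAGONAL upgrade `localZoomFrame_diag` ((U0)/(U1)
locally uniform space–time convergence + joint analyticity of the profile and of its gradient)):

* `localPointZoomVelGradSlicesDiag` — at a point where a classical Leray–Hopf flow is LOCALLY Type I but not backward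
  bounded, some zoom sequence `λⱼ → 0⁺` converges to a backward-singular profile `v` of the Type-I class, and for every
  `s < 0`, every `y` AND EVERY SEQUENCE `yⱼ → y`: `(λⱼ/ν) u(T + λⱼ²s/ν, x₀ + λⱼ yⱼ) → v(s,y)` and
  `(λⱼ²/ν) ∇u(T + λⱼ²s/ν, x₀ + λⱼ yⱼ) → ∇v(s)(y)`.

PURPOSE: window data of GRADIENT-based doors (sine / one-direction / Lamb / stretching / production) read along MOVING
points or windows, and symmetry inheritance at the gradient level; companion of
`…LocalVelCompTubeDoorLocalPointZoomVelSlicesDiag` (velocities only).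

WHAT THIS IS NOT: not a claim about Navier–Stokes regularity; a blow-up/compactness lemma for door routes
(bears_on LADDER-NS N0).
-/

noncomputable section

-- the summit and its single sub-problem share the name (CONVENTIONS §1), as in every Theorems file
set_option linter.dupNamespace false

namespace Summit.NavierStokesRegularity.NavierStokesRegularity.Theorems.LocalSineTubeDoorLocalPointZoomGradSlicesDiag

open MeasureTheory Set Function Filter Topology TopologicalSpace Metric
open Literature.Analysis Literature.Analysis.FluidPDE Literature.Analysis.FluidPDE.SereginSverak2009
open Summit.NavierStokesRegularity.NavierStokesRegularity.Theorems
open Summit.NavierStokesRegularity.NavierStokesRegularity.Theorems.LocalSineTubeDoorLocalPointZoomFrame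
open Summit.NavierStokesRegularity.NavierStokesRegularity.Theorems.LocalSineTubeDoorLocalPointZoomCurl
open Summit.NavierStokesRegularity.NavierStokesRegularity.Theorems.LocalSineTubeDoorLocalPointZoomSlices
open Summit.NavierStokesRegularity.NavierStokesRegularity.Theorems.LocalVelCompTubeDoorLocalPointZoomVel
open Summit.NavierStokesRegularity.NavierStokesRegularity.Theorems.LocalSineTubeDoorLocalPointZoomGrad
open Summit.NavierStokesRegularity.NavierStokesRegularity.Theorems.LocalSineTubeDoorLocalPointZoomDiag
open Summit.NavierStokesRegularity.NavierStokesRegularity.Theorems.LocalSineTubeDoorLocalPointZoomGradSlices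
open scoped NNReal ENNReal

/-- **LOCAL POINT ZOOM LIMIT WITH VELOCITY AND GRADIENT SLICES** (the universal first-order zoom crux of the door
family): at a point where a classical Leray–Hopf flow from rapidly decaying data is LOCALLY Type I but not backward
bounded, some zoom sequence `λⱼ → 0⁺` of unit-viscosity rescalings converges to a Type-I-rate, continuous, Oseen-mild,
divergence-free profile `v` with backward-singular apex, and at EVERY `s < 0`, `y`, BOTH the rescaled velocities
`(λⱼ/ν) u(T + λⱼ²s/ν, x₀ + λⱼy) → v(s,y)` AND the rescaled velocity gradients
`(λⱼ²/ν) Du(T + λⱼ²s/ν)(x₀ + λⱼy) → Dv(s)(y)` (operator norm) — along ONE common sequence `λⱼ`. -/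
theorem localPointZoomVelGradSlicesDiag :
    ∀ (ν T : ℝ), 0 < ν → 0 < T → ∀ (u : ℝ → EuclideanSpace ℝ (Fin 3) → EuclideanSpace ℝ (Fin 3))
      (p : ℝ → EuclideanSpace ℝ (Fin 3) → ℝ),
    Literature.Analysis.FluidPDE.IsClassicalNSSolutionOn (Set.Ico 0 T) ν 0 u p →
    Literature.Analysis.FluidPDE.IsLerayHopfOn T ν 0 (u 0) u →
    Literature.Analysis.FluidPDE.HasRapidSpatialDecay (u 0) →
    ∀ (x₀ : EuclideanSpace ℝ (Fin 3)) (ρ M : ℝ), 0 < ρ →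
    (∀ t ∈ Set.Ico 0 T, T - ρ ^ 2 < t → ∀ x ∈ Metric.ball x₀ ρ, ‖u t x‖ * Real.sqrt (ν * (T - t)) ≤ M) →
    ¬ Literature.Analysis.FluidPDE.IsBackwardBoundedAt u T x₀ →
    ∃ (C : ℝ) (v : ℝ → EuclideanSpace ℝ (Fin 3) → EuclideanSpace ℝ (Fin 3)) (lam : ℕ → ℝ),
      (∀ j, 0 < lam j) ∧ Filter.Tendsto lam Filter.atTop (nhds 0) ∧
      (Literature.Analysis.FluidPDE.HasTypeITimeDecay C v ∧
        ContinuousOn (Function.uncurry v) (Set.Iio (0 : ℝ) ×ˢ Set.univ) ∧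
        (∀ s t : ℝ, s < t → t < 0 → ∀ x, v t x =
          Literature.Analysis.UnboundedOperators.heatExtension (v s) (t - s) x -
            Literature.Analysis.FluidPDE.oseenDuhamel 1 s v v t x) ∧
        (∀ t < 0, Literature.Analysis.FluidPDE.VectorCalculus.IsDivFree (v t))) ∧
      Literature.Analysis.FluidPDE.IsBackwardSingularPoint v 0 ∧
      ∀ s < 0, ∀ (y : EuclideanSpace ℝ (Fin 3)) (yseq : ℕ → EuclideanSpace ℝ (Fin 3)),
        Filter.Tendsto yseq Filter.atTop (nhds y) →
        Filter.Tendsto (fun j => (lam j / ν) • u (T + lam j ^ 2 * s / ν) (x₀ + lam j • yseq j)) Filter.atTop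
          (nhds (v s y)) ∧
        Filter.Tendsto (fun j => (lam j ^ 2 / ν) •
          fderiv ℝ (u (T + lam j ^ 2 * s / ν)) (x₀ + lam j • yseq j)) Filter.atTop
          (nhds (fderiv ℝ (v s) y)) := by
  intro ν T hν hT u p hsol hLH _ x₀ ρ M hρ hM hnotbd
  obtain ⟨R, C₁, v', π', lam, w, v₁, Ks, r₁, hR, hlam, hlam0, hball1, hr₁, hr₁1, hKs, hL3, hae, hP,
    hsing₁, hpt⟩ := localTreeZoomFrame hν hT hsol hLH hρ hM hnotbd
  refine ⟨C₁, v₁, fun j => R * (lam j / 2), fun j => mul_pos hR (half_pos (hlam j)),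
    by simpa using (hlam0.div_const 2).const_mul R, hP, hsing₁, fun s hs y yseq hyseq => ?_⟩
  -- ## the scaling factor `σ = √(−s)`
  have hns : 0 < -s := neg_pos.2 hs
  set σ : ℝ := Real.sqrt (-s) with hσdef
  have hσ : 0 < σ := Real.sqrt_pos.2 hns
  have hσ2 : σ ^ 2 = -s := Real.sq_sqrt hns.le
  have hσne : σ ≠ 0 := hσ.ne'
  -- ## the rescaled frame
  set lam' : ℕ → ℝ := fun j => σ * lam j with hlam'def
  have hlam' : ∀ j, 0 < lam' j := fun j => mul_pos hσ (hlam j)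
  have hlam0' : Tendsto lam' atTop (𝓝 0) := by
    show Tendsto (fun j => σ * lam j) atTop (𝓝 0)
    simpa using hlam0.const_mul σ
  set w' : ℝ → (EuclideanSpace ℝ (Fin 3)) → (EuclideanSpace ℝ (Fin 3)) :=
    σ • stPull (σ ^ 2) σ (0 : ℝ) (0 : (EuclideanSpace ℝ (Fin 3))) w with hw'def
  set v₁' : ℝ → (EuclideanSpace ℝ (Fin 3)) → (EuclideanSpace ℝ (Fin 3)) :=
    σ • stPull (σ ^ 2) σ (0 : ℝ) (0 : (EuclideanSpace ℝ (Fin 3))) v₁ with hv₁'def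
  have hZZ : ∀ j, (lam' j) • stPull ((lam' j) ^ 2) (lam' j) (0 : ℝ) (0 : (EuclideanSpace ℝ (Fin 3))) v' =
      σ • stPull (σ ^ 2) σ (0 : ℝ) (0 : (EuclideanSpace ℝ (Fin 3)))
        ((lam j) • stPull ((lam j) ^ 2) (lam j) (0 : ℝ) (0 : (EuclideanSpace ℝ (Fin 3))) v') := by
    intro j
    simp only [hlam'def]
    rw [zoom_zoom]
  -- (pt') identification with the zooms of `u` at the scales `R σλⱼ/2`
  have hpt' : ∀ (j : ℕ) (s' : ℝ) (y' : (EuclideanSpace ℝ (Fin 3))),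
      ((lam' j) • stPull ((lam' j) ^ 2) (lam' j) (0 : ℝ) (0 : (EuclideanSpace ℝ (Fin 3))) v') s' y' =
        ((R * (lam' j / 2)) / ν) • u (T + (R * (lam' j / 2)) ^ 2 * s' / ν) (x₀ + (R * (lam' j / 2)) • y') := by
    intro j s' y'
    have h := hpt j (σ ^ 2 * s') (σ • y')
    simp only [smul_stPull_apply, zero_add] at h ⊢
    simp only [hlam'def]
    rw [show (σ * lam j) ^ 2 * s' = lam j ^ 2 * (σ ^ 2 * s') by ring,
      show (σ * lam j) • y' = lam j • σ • y' by rw [smul_smul, mul_comm],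
      mul_smul, h, smul_smul, smul_smul,
      show σ * (R * (lam j / 2) / ν) = R * (σ * lam j / 2) / ν by ring,
      show T + (R * (lam j / 2)) ^ 2 * (σ ^ 2 * s') / ν = T + (R * (σ * lam j / 2)) ^ 2 * s' / ν by ring,
      show R * (lam j / 2) * σ = R * (σ * lam j / 2) by ring]
  -- (L3') local `L³` convergence of the rescaled zooms to `w'`
  have hus : ∀ f g : ℝ → (EuclideanSpace ℝ (Fin 3)) → (EuclideanSpace ℝ (Fin 3)),
      uncurry (f - g) = uncurry f - uncurry g := fun f g => rfl
  have hL3' : ∀ a : ℝ, 0 < a → Tendsto (fun j => eLpNorm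
      (uncurry ((lam' j) • stPull ((lam' j) ^ 2) (lam' j) (0 : ℝ) (0 : (EuclideanSpace ℝ (Fin 3))) v') - uncurry w') 3
      (volume.restrict (parabolicCylinder a (0 : ℝ × (EuclideanSpace ℝ (Fin 3)))))) atTop (𝓝 0) := by
    intro a ha
    have hdiff : ∀ j, uncurry ((lam' j) • stPull ((lam' j) ^ 2) (lam' j) (0 : ℝ) (0 : (EuclideanSpace ℝ (Fin 3))) v') -
        uncurry w' = uncurry (σ • stPull (σ ^ 2) σ (0 : ℝ) (0 : (EuclideanSpace ℝ (Fin 3)))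
          ((lam j) • stPull ((lam j) ^ 2) (lam j) (0 : ℝ) (0 : (EuclideanSpace ℝ (Fin 3))) v' - w)) := by
      intro j
      rw [hZZ j]
      funext z
      obtain ⟨s', y'⟩ := z
      simp only [hw'def, uncurry_apply_pair, Pi.sub_apply, smul_stPull_apply, smul_sub]
    have hconst : (‖σ‖ₑ * (ENNReal.ofReal ((σ ^ 2 * σ ^ 3)⁻¹)) ^ (1 / (3 : ℝ≥0∞).toReal)) ≠ ⊤ :=
      ENNReal.mul_ne_top enorm_ne_top
        (ENNReal.rpow_ne_top_of_nonneg (one_div_nonneg.2 ENNReal.toReal_nonneg) ENNReal.ofReal_ne_top)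
    have key := ENNReal.Tendsto.const_mul (hL3 (a * σ) (mul_pos ha hσ)) (Or.inr hconst)
    rw [mul_zero] at key
    refine key.congr fun j => ?_
    rw [hdiff j]
    conv_rhs => rw [show a = a * σ / σ by field_simp]
    rw [eLpNorm_uncurry_zoom hσ σ _ (a * σ) three_ne_zero ENNReal.ofNat_ne_top, hus]
  -- (ae') the rescaled limit agrees a.e. with the rescaled profile
  have hslab : stAffine (σ ^ 2) σ (0 : ℝ) (0 : (EuclideanSpace ℝ (Fin 3))) ⁻¹'
      (Iio (0 : ℝ) ×ˢ (univ : Set (EuclideanSpace ℝ (Fin 3)))) =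
      Iio (0 : ℝ) ×ˢ (univ : Set (EuclideanSpace ℝ (Fin 3))) := by
    ext z
    simp only [mem_preimage, mem_prod, mem_Iio, mem_univ, and_true, stAffine_fst, zero_add]
    exact ⟨fun h => neg_of_mul_neg_right h (pow_pos hσ 2).le,
      fun h => mul_neg_of_pos_of_neg (pow_pos hσ 2) h⟩
  have hae' : ∀ᵐ x ∂(volume.restrict (Iio (0 : ℝ) ×ˢ (univ : Set (EuclideanSpace ℝ (Fin 3))))),
      uncurry w' x = uncurry v₁' x := by
    have h := ae_eq_restrict_comp_stAffine (f := uncurry w) (g := uncurry v₁) (pow_pos hσ 2) hσ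
      (0 : ℝ) (0 : (EuclideanSpace ℝ (Fin 3))) hae
    rw [hslab] at h
    filter_upwards [h] with z hz
    show σ • uncurry w (stAffine (σ ^ 2) σ (0 : ℝ) (0 : (EuclideanSpace ℝ (Fin 3))) z) =
      σ • uncurry v₁ (stAffine (σ ^ 2) σ (0 : ℝ) (0 : (EuclideanSpace ℝ (Fin 3))) z)
    rw [show uncurry w (stAffine (σ ^ 2) σ (0 : ℝ) (0 : (EuclideanSpace ℝ (Fin 3))) z) =
      uncurry v₁ (stAffine (σ ^ 2) σ (0 : ℝ) (0 : (EuclideanSpace ℝ (Fin 3))) z) from hz]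
  -- (P') the rescaled profile is in the class (scaling invariance of rate / continuity / mildness)
  have hrate' : HasTypeITimeDecay C₁ v₁' := rate_smul_stPull hP.1 hσ
  have hcont' : ContinuousOn (uncurry v₁') (Iio (0 : ℝ) ×ˢ univ) := cont_smul_stPull hP.2.1 hσ
  have hmild' := mild_smul_stPull hP.2.2.1 hσ
  -- ## common bookkeeping: the time and the scale at slice `s`
  have e2 : ∀ j, T + (R * (σ * lam j / 2)) ^ 2 * (-1) / ν = T + (R * (lam j / 2)) ^ 2 * s / ν := by
    intro j
    have hs' : s = -σ ^ 2 := by rw [hσ2]; ring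
    rw [hs']; ring
  have e3 : ∀ j, R * (σ * lam j / 2) * σ⁻¹ = R * (lam j / 2) := by
    intro j
    calc R * (σ * lam j / 2) * σ⁻¹ = R * (lam j / 2) * (σ * σ⁻¹) := by ring
      _ = R * (lam j / 2) := by rw [mul_inv_cancel₀ hσne, mul_one]
  refine ⟨?_, ?_⟩
  · -- ## (i) VELOCITIES: the velocity upgrade at time `−1` of the rescaled frame
    have hyseq' : Tendsto (fun j => σ⁻¹ • yseq j) atTop (𝓝 (σ⁻¹ • y)) := hyseq.const_smul σ⁻¹
    have key := (localZoomFrame_diag hν hT hsol.smooth_velocity.continuousOn hρ hM hR hball1 hlam'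
      hlam0' hr₁ hr₁1 hKs hpt' hL3' hae' hrate' hcont' hmild' (σ⁻¹ • y) tendsto_const_nhds hyseq').1
    have hZ : ∀ j, ((lam' j) • stPull ((lam' j) ^ 2) (lam' j) (0 : ℝ) (0 : (EuclideanSpace ℝ (Fin 3))) v') (-1)
        (σ⁻¹ • yseq j) = σ • (((R * (lam j / 2)) / ν) • u (T + (R * (lam j / 2)) ^ 2 * s / ν)
          (x₀ + (R * (lam j / 2)) • yseq j)) := by
      intro j
      rw [hpt' j (-1) (σ⁻¹ • yseq j)]
      simp only [hlam'def, smul_smul]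
      have e4 : R * (σ * lam j / 2) / ν = σ * (R * (lam j / 2) / ν) := by ring
      rw [e2 j, e3 j, e4]
    have hlimit : v₁' (-1) (σ⁻¹ • y) = σ • v₁ s y := by
      simp only [hv₁'def, smul_stPull_apply, smul_smul, mul_inv_cancel₀ hσne, one_smul, zero_add]
      rw [show σ ^ 2 * (-1) = s by rw [hσ2]; ring]
    have key' : Tendsto (fun j => σ • (((R * (lam j / 2)) / ν) •
        u (T + (R * (lam j / 2)) ^ 2 * s / ν) (x₀ + (R * (lam j / 2)) • yseq j))) atTop (𝓝 (σ • v₁ s y)) := by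
      rw [← hlimit]
      exact Tendsto.congr hZ key
    have key3 := key'.const_smul σ⁻¹
    simp only [smul_smul, inv_mul_cancel_left₀ hσne, inv_mul_cancel₀ hσne, one_smul] at key3
    exact key3
  · -- ## (ii) GRADIENTS: the gradient upgrade at time `−1` of the rescaled frame
    have hyseq' : Tendsto (fun j => σ⁻¹ • yseq j) atTop (𝓝 (σ⁻¹ • y)) := hyseq.const_smul σ⁻¹
    have key := (localZoomFrame_diag hν hT hsol.smooth_velocity.continuousOn hρ hM hR hball1 hlam'
      hlam0' hr₁ hr₁1 hKs hpt' hL3' hae' hrate' hcont' hmild' (σ⁻¹ • y) tendsto_const_nhds hyseq').2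
    have hgradZ : ∀ j, fderiv ℝ (((lam' j) • stPull ((lam' j) ^ 2) (lam' j) (0 : ℝ) (0 : (EuclideanSpace ℝ (Fin 3))) v') (-1))
        (σ⁻¹ • yseq j) = (-s) • (((R * (lam j / 2)) ^ 2 / ν) •
          fderiv ℝ (u (T + (R * (lam j / 2)) ^ 2 * s / ν)) (x₀ + (R * (lam j / 2)) • yseq j)) := by
      intro j
      have hfun : ((lam' j) • stPull ((lam' j) ^ 2) (lam' j) (0 : ℝ) (0 : (EuclideanSpace ℝ (Fin 3))) v') (-1) =
          (((R * (lam' j / 2)) / ν) • stPull ((R * (lam' j / 2)) ^ 2 / ν) (R * (lam' j / 2)) T x₀ u)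
            (-1) := by
        funext y'
        rw [hpt' j (-1) y', smul_stPull_apply]
        congr 2
        ring
      have e1 : R * (σ * lam j / 2) / ν * (R * (σ * lam j / 2)) = (-s) * ((R * (lam j / 2)) ^ 2 / ν) := by
        rw [← hσ2]; ring
      rw [hfun, fderiv_smul_stPull]
      simp only [hlam'def, smul_smul]
      rw [e1, show T + (R * (σ * lam j / 2)) ^ 2 / ν * (-1) = T + (R * (lam j / 2)) ^ 2 * s / ν by
        rw [← e2 j]; ring, e3 j]
    have hlimit : fderiv ℝ (v₁' (-1)) (σ⁻¹ • y) = (-s) • fderiv ℝ (v₁ s) y := by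
      simp only [hv₁'def]
      rw [fderiv_smul_stPull]
      simp only [smul_smul, mul_inv_cancel₀ hσne, one_smul, zero_add]
      rw [show σ ^ 2 * (-1) = s by rw [hσ2]; ring, show σ * σ = -s by rw [← hσ2]; ring]
    have key' : Tendsto (fun j => (-s) • (((R * (lam j / 2)) ^ 2 / ν) •
        fderiv ℝ (u (T + (R * (lam j / 2)) ^ 2 * s / ν)) (x₀ + (R * (lam j / 2)) • yseq j))) atTop
        (𝓝 ((-s) • fderiv ℝ (v₁ s) y)) := by
      rw [← hlimit]
      exact Tendsto.congr hgradZ key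
    have key3 := key'.const_smul (-s)⁻¹
    simp only [smul_smul, inv_mul_cancel₀ hns.ne', inv_mul_cancel_left₀ hns.ne', one_smul]
      at key3
    exact key3

/-- **Diagonal convergence of VELOCITIES, GRADIENTS and VORTICITIES on every slice** (appended corollary): along the same
zoom, the rescaled vorticities `(λⱼ²/ν) curl u(T + λⱼ²s/ν)(x₀ + λⱼ yⱼ)` converge to `curl v(s)(y)` for every `yⱼ → y`
(`curl = curlCLM ∘ fderiv` is linear and continuous in the gradient). This is K1‴ of door S11 / the vorticity zoom of the
Sine and Poloidal doors in DIAGONAL form. -/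
theorem localPointZoomVelGradCurlSlicesDiag :
    ∀ (ν T : ℝ), 0 < ν → 0 < T → ∀ (u : ℝ → EuclideanSpace ℝ (Fin 3) → EuclideanSpace ℝ (Fin 3))
      (p : ℝ → EuclideanSpace ℝ (Fin 3) → ℝ),
    Literature.Analysis.FluidPDE.IsClassicalNSSolutionOn (Set.Ico 0 T) ν 0 u p →
    Literature.Analysis.FluidPDE.IsLerayHopfOn T ν 0 (u 0) u →
    Literature.Analysis.FluidPDE.HasRapidSpatialDecay (u 0) →
    ∀ (x₀ : EuclideanSpace ℝ (Fin 3)) (ρ M : ℝ), 0 < ρ →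
    (∀ t ∈ Set.Ico 0 T, T - ρ ^ 2 < t → ∀ x ∈ Metric.ball x₀ ρ, ‖u t x‖ * Real.sqrt (ν * (T - t)) ≤ M) →
    ¬ Literature.Analysis.FluidPDE.IsBackwardBoundedAt u T x₀ →
    ∃ (C : ℝ) (v : ℝ → EuclideanSpace ℝ (Fin 3) → EuclideanSpace ℝ (Fin 3)) (lam : ℕ → ℝ),
      (∀ j, 0 < lam j) ∧ Filter.Tendsto lam Filter.atTop (nhds 0) ∧
      (Literature.Analysis.FluidPDE.HasTypeITimeDecay C v ∧
        ContinuousOn (Function.uncurry v) (Set.Iio (0 : ℝ) ×ˢ Set.univ) ∧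
        (∀ s t : ℝ, s < t → t < 0 → ∀ x, v t x =
          Literature.Analysis.UnboundedOperators.heatExtension (v s) (t - s) x -
            Literature.Analysis.FluidPDE.oseenDuhamel 1 s v v t x) ∧
        (∀ t < 0, Literature.Analysis.FluidPDE.VectorCalculus.IsDivFree (v t))) ∧
      Literature.Analysis.FluidPDE.IsBackwardSingularPoint v 0 ∧
      ∀ s < 0, ∀ (y : EuclideanSpace ℝ (Fin 3)) (yseq : ℕ → EuclideanSpace ℝ (Fin 3)),
        Filter.Tendsto yseq Filter.atTop (nhds y) →
        Filter.Tendsto (fun j => (lam j / ν) • u (T + lam j ^ 2 * s / ν) (x₀ + lam j • yseq j)) Filter.atTop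
          (nhds (v s y)) ∧
        Filter.Tendsto (fun j => (lam j ^ 2 / ν) •
          fderiv ℝ (u (T + lam j ^ 2 * s / ν)) (x₀ + lam j • yseq j)) Filter.atTop
          (nhds (fderiv ℝ (v s) y)) ∧
        Filter.Tendsto (fun j => (lam j ^ 2 / ν) •
          Literature.Analysis.FluidPDE.curl (u (T + lam j ^ 2 * s / ν)) (x₀ + lam j • yseq j)) Filter.atTop
          (nhds (Literature.Analysis.FluidPDE.curl (v s) y)) := by
  intro ν T hν hT u p hsol hLH hdec x₀ ρ M hρ hM hnotbd
  obtain ⟨C, v, lam, hlam, hlam0, hP, hsing, hconv⟩ :=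
    localPointZoomVelGradSlicesDiag ν T hν hT u p hsol hLH hdec x₀ ρ M hρ hM hnotbd
  refine ⟨C, v, lam, hlam, hlam0, hP, hsing, fun s hs y yseq hyseq => ?_⟩
  obtain ⟨hv, hg⟩ := hconv s hs y yseq hyseq
  refine ⟨hv, hg, ?_⟩
  have hc := (curlCLM.continuous.tendsto _).comp hg
  have e1 : (fun j => (lam j ^ 2 / ν) • curl (u (T + lam j ^ 2 * s / ν)) (x₀ + lam j • yseq j)) =
      fun j => curlCLM ((lam j ^ 2 / ν) • fderiv ℝ (u (T + lam j ^ 2 * s / ν)) (x₀ + lam j • yseq j)) := by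
    funext j; rw [map_smul, ← curl_eq_curlCLM]
  rw [e1, curl_eq_curlCLM]
  exact hc

end Summit.NavierStokesRegularity.NavierStokesRegularity.Theorems.LocalSineTubeDoorLocalPointZoomGradSlicesDiag

end
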